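import Mathlib
import HarnessLib
import Literature.NumberTheory.Automorphic.StrongArtinGL2
import Literature.NumberTheory.Automorphic.TunnellOctahedralGlobal
import Literature.NumberTheory.Automorphic.TunnellOctahedralLocal
import Literature.NumberTheory.GaloisRepresentations.ArtinRestriction

/-!
# Ascent of `π = π(σ)` along a weak base-change lift (stub `stub_bcAscent`, crux
stmt-Langlands-15111, line Sketch, odd base-change sector of R′)

If `π = π(σ)` over `F` in Tunnell's almost-everywhere sense (`IsPiOfArtinRep σ π`) and the
automorphic representation `P` of `GL₂(𝔸_E)` is a weak base-change lift of `π`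
(`IsWeakBaseChangeLiftAE π P`: `t_{P,w} = t_{π,v}^{f(w|v)}` for almost all `w`), then
`P = π(σ|_{Γ_E})` almost everywhere: at a good place `w ∣ v` the Satake parameter of `P` is
`{a^f, b^f}` where `{a, b} = t_{π,v}` are the Frobenius eigenvalues of `σ` at `v`, and
`charpoly σ|_{Γ_E}(Frob_w) = (X - a^f)(X - b^f)`
(`FramedGaloisRep.hasFrobCharpolyAt_restrictField_fin_two`). Pure almost-everywhere
bookkeeping along `w ↦ w ∩ 𝓞 F` (`eventually_under`), as in
`isGaloisStableSatakeAE_of_isPiOfArtinRep` of `Automorphic/TunnellOctahedralGlobal`.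
-/

noncomputable section

open scoped NumberField MatrixGroups
open Literature.NumberTheory.Automorphic Literature.NumberTheory.GaloisRepresentations
  IsDedekindDomain NumberField Filter

-- `Summit.Langlands.Langlands.…`: summit = sub-problem name (D-0017 nested layout), not a typo.
set_option linter.dupNamespace false

namespace Summit.Langlands.Langlands.Theorems.ArtinWeightRealisationLevel

/-- **Ascent of `π = π(σ)` along a weak base-change lift.**  If `π = π(σ)` over `F`
(a.e.) and `P` on `GL₂(𝔸_E)` is a weak base-change lift of `π`, then `P = π(σ|_{Γ_E})` (a.e.):
at almost every place `w` of `E`, with `v` the place of `F` below `w`, `f = f(w|v)` and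
`t_{π,v} = {a, b}` the Frobenius eigenvalues of `σ` at `v`, the lift has Satake parameter
`{a^f, b^f}` at `w`, `σ|_{Γ_E}` is unramified at `w`
(`FramedGaloisRep.isUnramifiedAt_restrictField`) and `charpoly σ|_{Γ_E}(Frob_w) =
(X - a^f)(X - b^f)` (`FramedGaloisRep.hasFrobCharpolyAt_restrictField_fin_two`). [folklore] -/
theorem stub_bcAscent : ∀ {F : Type} [Field F] [NumberField F] {E : Type} [Field E] [NumberField E]
    [Algebra F E] (σ : Literature.NumberTheory.GaloisRepresentations.FramedArtinRep F 2) {hF :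
    Literature.NumberTheory.Automorphic.isCompact_glFiniteIntegralLevel 2 F} {hE :
    Literature.NumberTheory.Automorphic.isCompact_glFiniteIntegralLevel 2 E} (π :
    Literature.NumberTheory.Automorphic.CuspidalAutomorphicRepData 2 F hF) (P :
    Literature.NumberTheory.Automorphic.CuspidalAutomorphicRepData 2 E hE),
    Literature.NumberTheory.Automorphic.IsPiOfArtinRep σ π.1 →
    Literature.NumberTheory.Automorphic.IsWeakBaseChangeLiftAE π.1 P.1 →
    Literature.NumberTheory.Automorphic.IsPiOfArtinRep (σ.restrictField E) P.1 := by
  intro F _ _ E _ _ _ σ hF hE π P hπ hP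
  -- good places `w`: the place `v` below carries the data of `IsPiOfArtinRep σ π`, and the
  -- base-change relation `t_{P,w} = t_{π,v}^{f(w|v)}` holds at `w`
  refine ((eventually_under (E := E) hπ).and hP).mono fun w ⟨hw1, hw2⟩ => ?_
  obtain ⟨v, hv⟩ := exists_under_eq (F := F) w
  obtain ⟨α, hα, hunr, hch⟩ := hw1 v hv
  obtain ⟨a, b, rfl⟩ := Multiset.card_eq_two.mp hα.card_eq
  refine ⟨_, hw2 v _ hv hα, FramedGaloisRep.isUnramifiedAt_restrictField σ hv hunr, ?_⟩
  rw [satakePolynomial_pair] at hch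
  have h1 := FramedGaloisRep.hasFrobCharpolyAt_restrictField_fin_two (E := E) σ hv hunr hch
  rw [← satakePolynomial_pair] at h1
  simpa using h1

end Summit.Langlands.Langlands.Theorems.ArtinWeightRealisationLevel

end
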